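import Summits.CriticalPhenomena.PercolationContinuityZ3.Theorems.PercNearOneGluingNoHeavyLowerTailKnQuestion8TwoRelays
import Summits.CriticalPhenomena.PercolationContinuityZ3.Theorems.PercNearOneGluingAdditiveGluingOffClusterAssociation
import HarnessLib

/-!
# The pre-FKG inequality (41) for two relays under EVERY pocket-restricted designation: a common generalisation of
# Kozma–Nitzan's Theorem 1 (Question 7), Question 8 and Question 9 at `|A| = 2`

Helper for crux `PercNearOneGluingNoHeavy.NoHeavyLowerTail` (item stmt-CriticalPhenomena-4575, closed), lemma factory
prim-lf-2 (deletion–contraction), gen 14.  No definitions, no named facts, no sorries; standard axioms.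

Setting: a finite weighted graph (`prodBernoulli w`), an observer `o`, a target `b`, two relays `a ≠ c` with `c ≠ o`;
`C_o` = the open (vertex) cluster of `o`, the "pocket" of the observer.  Let `𝒟` be ANY down-closed family of vertex sets
none of which contains `c`, and `D = {C_o ∈ 𝒟}` the corresponding decreasing event ("the pocket of `o` is small, and in
particular misses `c`").  Kozma–Nitzan (arXiv:2401.12397, §5.5 p. 36) ask for which designated relay the pre-FKG inequality
(41) `P(o↔b, o↔A) ≥ P(o↔A, c↔b)` holds; their three candidates designate `c` by `P(c↔b)` (Question 7; Theorem 1 for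
`|A| = 2`), by `P(c↔b, o↮A)` (Question 8) and by `P_{G∖E(o)}(c↔b)` (Question 9).

* `KnQ8.block41_pair_of_downEvent` — **MAIN THEOREM.**  If `μ({c↔b} ∩ D) ≤ μ({a↔b} ∩ D)` (the relay `c` is the weaker
  one ON THE EVENT `D`) and `μ({c↮a} ∩ {c↮o} ∩ D) > 0`, then `μ({c↔b} ∩ {o↔{a,c}}) ≤ μ({o↔b} ∩ {o↔{a,c}})`.
  SPECIAL CASES (`|A| = 2`, `A = {a,c}`):  `𝒟 = {S | c ∉ S}` (`D = {o↮c}`): Theorem 1 / Question 7 in restricted form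
  (`block41_pair_of_le_off_c`; the plain hypothesis `μ(c↔b) ≤ μ(a↔b)` implies the restricted one by Lemma 3(ii));
  `𝒟 = {S | a, c ∉ S}` (`D = {o↮A}`): Question 8 (tree `KnQ8.knQuestion8_pair`, prim-lf-2 gen 14);  `𝒟 = {{o}}`, more
  precisely `S ⊆ {o}` (`D = {o isolated}`, `μ({·↔b} ∩ D) = μ(o isolated)·μ_{G∖E(o)}(·↔b)`): Question 9 (tree
  `KnQ9.knQuestion9_two`, gen 13);  `𝒟 = {S | S ∩ T = ∅}` for any vertex set `T ∋ c`, `o ∉ T` (`D = {o↮T}`,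
  `block41_pair_of_avoid`): the whole interpolating family, e.g. `T` a vertex cut between `o` and the relays; and every
  union of such (`𝒟` arbitrary).  The exact census of the seat memo (prim-lf-2/Q8Q9-LANDSCAPE-gen14.md §2–3: ≈ 60 000
  designated instances) found this "master designation" family with 0 violations for every `|A|` and located the failure
  of every tested designation outside it (`T ⊉ A` non-separating, `|C_o|`-weights, the relay-dependent `{c ∉ C_o}` at `|A| ≥ 3`…).
* PROOF (four tree inequalities, no case analysis).  `N := {c↮a} ∩ {c↮o} = {C_c ∩ {a,o} = ∅}`.
  (0) On `{c↔a}` the two scores agree and `D ⊆ {o↮c}`, so the hypothesis is `μ(N∩D∩{c↔b}) ≤ μ(N∩D∩{a↔b})`.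
  (1) `μ(N∩{c↔b})·μ(N∩D) ≤ μ(N)·μ(N∩D∩{c↔b})` — given `N`, the `C_c`-increasing event `{c↔b}` and the `C_o`-increasing
      event `Dᶜ` are negatively correlated (`rbhk_neg`, vdBHK Thm 1.5 conditioned on `{C_c ∩ X = ∅}`).
  (2) `μ(N)·μ(N∩D∩{a↔b}) ≤ μ(N∩{a↔b})·μ(N∩D)` (`negCorr_conn_downEvent`) — given `N`, `{a↔b}` is an INCREASING and `D` a
      DECREASING event of the configuration OFF the cluster of `c`, hence negatively correlated: prim-lf-1/c11's
      off-cluster association `OffCluster.offCluster_event_negCorr` (vdBHK's proof of Thm 1.5: condition on `C_c = W`,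
      Harris in the fresh variables, monotonicity in `W`, Thm 1.3 for `C_c` given `N`).
  (1)+(0)+(2): `μ(N∩{c↔b})μ(N∩D) ≤ μ(N)μ(N∩D∩{c↔b}) ≤ μ(N)μ(N∩D∩{a↔b}) ≤ μ(N∩{a↔b})μ(N∩D)`, so `μ(N∩{c↔b}) ≤ μ(N∩{a↔b})`
  (`restricted_le_of_le_on_downEvent`): the comparison holds on ALL of `N`.  (3) Kozma–Nitzan's Lemma 3(i) restricted to
  `N` (`knLemma3i_restricted`, increasing event `{a↔o}` of `C_a`) transfers it onto `N ∩ {a↔o}`, which is (41) minus the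
  common part on `{o↔c}` (`KnQ8.block41_of_core`).
* `KnQ8.block41_pair_of_avoid`, `…_of_avoid_lt_one` — the `T`-family (`D = {o↮T}`, `c ∈ T ∌ o`), the second for every
  weight vector without weight-`1` pairs (the empty configuration gives the positive mass); `KnQ8.block41_pair_of_le_off_c`
  — `T = {c}`.  (`T = {a,c}` is verbatim the landed `KnQ8.knQuestion8_pair_core`.)
[cite: KozmaNitzan2024, Questions 7–9 (§5.5 p. 36); Theorem 1 (pp. 7–8); Lemma 3 (pp. 6–7)]
[cite: VandenbergHaggstromKahn2005, Thms. 1.3–1.5 (pp. 6–8), proof of Thm. 1.5 (pp. 7–8)]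
-/

noncomputable section

namespace Summit.CriticalPhenomena.PercolationContinuityZ3.Theorems

open MeasureTheory Set
open Literature.Probability.LatticeModels (prodBernoulli)
open Literature.Probability.Percolation
open Summit.CriticalPhenomena.PercolationContinuityZ3.Cruxes.AdditiveGluing.TieLine
open scoped Classical

namespace KnQ8

variable {V : Type*} [Fintype V]

/-! ### Step (2): a connection off the cluster of `c` and a decreasing pocket event are negatively correlated given `N` -/

omit [Fintype V] in
/-- Off the cluster of `c`, the pocket of `o` is unchanged (`o ↮ c`). [cite: VandenbergHaggstromKahn2005, §1 p. 8] -/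
theorem openCluster_off_eq (ω : BondConfig V) (o c : V) (h : ¬ (openGraph ω).Reachable o c) :
    {y | (openGraph (ω \ {e | ∃ v ∈ e, v = c ∨ ∃ e' ∈ openEdgeCluster ω c, v ∈ e'})).Reachable o y} = openCluster ω o := by
  ext y
  simp only [mem_setOf_eq, openCluster]
  exact (OffCluster.reachable_off_iff h y).symm

/-- **(2)** Given `N = {C_c ∩ {a,o} = ∅}` (`a ≠ c`, `o ≠ c`), the increasing event `{a↔b}` and the decreasing pocket event
`D = {C_o ∈ 𝒟}` (`𝒟` down-closed) are NEGATIVELY correlated: `μ(N)·μ(N ∩ {a↔b} ∩ D) ≤ μ(N ∩ {a↔b})·μ(N ∩ D)`.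
(`OffCluster.offCluster_event_negCorr` with `s = c`, `X = {a, o}`: on `N` both events are read off the configuration off `C̄_c`,
one increasing, one decreasing.) [cite: VandenbergHaggstromKahn2005, Thm. 1.5 (p. 7), proof pp. 7–8] -/
theorem negCorr_conn_downEvent (w : Sym2 V → unitInterval) (o a b c : V) (hac : a ≠ c) (hoc : o ≠ c)
    (𝒟 : Set (Set V)) (h𝒟 : ∀ S S' : Set V, S ⊆ S' → S' ∈ 𝒟 → S ∈ 𝒟) :
    (prodBernoulli w).real {ω : BondConfig V | ∀ x ∈ ({a, o} : Set V), ¬ (openGraph ω).Reachable c x} *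
        (prodBernoulli w).real ({ω : BondConfig V | ∀ x ∈ ({a, o} : Set V), ¬ (openGraph ω).Reachable c x} ∩
          openConn a b ∩ {ω | openCluster ω o ∈ 𝒟}) ≤
      (prodBernoulli w).real ({ω : BondConfig V | ∀ x ∈ ({a, o} : Set V), ¬ (openGraph ω).Reachable c x} ∩ openConn a b) *
        (prodBernoulli w).real ({ω : BondConfig V | ∀ x ∈ ({a, o} : Set V), ¬ (openGraph ω).Reachable c x} ∩
          {ω | openCluster ω o ∈ 𝒟}) := by
  set μ := prodBernoulli w with hμ
  set X : Set V := {a, o} with hX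
  set N : Set (BondConfig V) := {ω | ∀ x ∈ X, ¬ (openGraph ω).Reachable c x} with hN
  have hNiff : ∀ ω : BondConfig V, ω ∈ N ↔ ¬ (openGraph ω).Reachable c a ∧ ¬ (openGraph ω).Reachable c o := by
    intro ω
    simp only [hN, hX, mem_setOf_eq, mem_insert_iff, mem_singleton_iff, forall_eq_or_imp, forall_eq]
  have hcX : c ∉ X := by
    simp only [hX, mem_insert_iff, mem_singleton_iff, not_or]
    exact ⟨fun h => hac h.symm, fun h => hoc h.symm⟩
  -- the off-cluster predicates
  set P : Set (Sym2 V) → Set (Sym2 V) → Prop := fun C E => (openGraph E).Reachable a b ∧ ¬ (a = c ∨ ∃ e ∈ C, a ∈ e) with hP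
  set Q : Set (Sym2 V) → Set (Sym2 V) → Prop := fun _ E => {y | (openGraph E).Reachable o y} ∈ 𝒟 with hQ
  have key := OffCluster.offCluster_event_negCorr w c X hcX P Q
    (fun _ _ _ hCC' h => ⟨h.1, fun h' => h.2 (h'.imp id fun ⟨e, he, hxe⟩ => ⟨e, hCC' he, hxe⟩)⟩)
    (fun _ _ _ hEE' h => ⟨h.1.mono (BHK2006.openGraph_le hEE'), h.2⟩)
    (fun _ _ _ _ h => h)
    (fun _ _ _ hEE' h => h𝒟 _ _ (fun y hy => SimpleGraph.Reachable.mono (BHK2006.openGraph_le hEE') hy) h)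
  -- identify the three events
  have eP : {ω : BondConfig V | P (openEdgeCluster ω c) (ω \ {e | ∃ v ∈ e, v = c ∨ ∃ e' ∈ openEdgeCluster ω c, v ∈ e'})} =
      (openConn a b ∩ (openConn a c)ᶜ : Set (BondConfig V)) := (OffCluster.openConn_inter_compl_eq c a b).symm
  have eNP : N ∩ (openConn a b ∩ (openConn a c)ᶜ : Set (BondConfig V)) = N ∩ openConn a b := by
    ext ω
    simp only [mem_inter_iff, mem_compl_iff, hNiff, openConn, mem_setOf_eq]
    constructor
    · rintro ⟨hn, hab, -⟩; exact ⟨hn, hab⟩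
    · rintro ⟨hn, hab⟩; exact ⟨hn, hab, fun h => hn.1 h.symm⟩
  have eNQ : N ∩ {ω : BondConfig V | Q (openEdgeCluster ω c) (ω \ {e | ∃ v ∈ e, v = c ∨ ∃ e' ∈ openEdgeCluster ω c, v ∈ e'})} =
      N ∩ {ω | openCluster ω o ∈ 𝒟} := by
    ext ω
    simp only [mem_inter_iff, mem_setOf_eq, hQ]
    constructor
    · rintro ⟨hn, hq⟩
      refine ⟨hn, ?_⟩
      rwa [openCluster_off_eq ω o c (fun h => ((hNiff ω).1 hn).2 h.symm)] at hq
    · rintro ⟨hn, hq⟩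
      refine ⟨hn, ?_⟩
      rwa [openCluster_off_eq ω o c (fun h => ((hNiff ω).1 hn).2 h.symm)]
  have eNPQ : N ∩ ({ω : BondConfig V | P (openEdgeCluster ω c) (ω \ {e | ∃ v ∈ e, v = c ∨ ∃ e' ∈ openEdgeCluster ω c, v ∈ e'})} ∩
      {ω | Q (openEdgeCluster ω c) (ω \ {e | ∃ v ∈ e, v = c ∨ ∃ e' ∈ openEdgeCluster ω c, v ∈ e'})}) =
      N ∩ openConn a b ∩ {ω | openCluster ω o ∈ 𝒟} := by
    rw [inter_inter_distrib_left, eP, eNP, eNQ, ← inter_inter_distrib_left, ← inter_assoc]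
  rw [eNPQ, eP, eNP, eNQ] at key
  exact key

/-- **(1)** Given `N`, the `C_c`-event `{c↔b}` and the decreasing pocket event `D` are POSITIVELY correlated:
`μ(N ∩ {c↔b})·μ(N ∩ D) ≤ μ(N)·μ(N ∩ {c↔b} ∩ D)` (`rbhk_neg` with the `C_o`-increasing event `Dᶜ`).
[cite: VandenbergHaggstromKahn2005, Thm. 1.5 (pp. 7–8)] -/
theorem posCorr_own_downEvent (w : Sym2 V → unitInterval) (o a b c : V) (hac : a ≠ c) (hoc : o ≠ c)
    (𝒟 : Set (Set V)) (h𝒟 : ∀ S S' : Set V, S ⊆ S' → S' ∈ 𝒟 → S ∈ 𝒟) :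
    (prodBernoulli w).real ({ω : BondConfig V | ∀ x ∈ ({a, o} : Set V), ¬ (openGraph ω).Reachable c x} ∩ openConn c b) *
        (prodBernoulli w).real ({ω : BondConfig V | ∀ x ∈ ({a, o} : Set V), ¬ (openGraph ω).Reachable c x} ∩
          {ω | openCluster ω o ∈ 𝒟}) ≤
      (prodBernoulli w).real {ω : BondConfig V | ∀ x ∈ ({a, o} : Set V), ¬ (openGraph ω).Reachable c x} *
        (prodBernoulli w).real ({ω : BondConfig V | ∀ x ∈ ({a, o} : Set V), ¬ (openGraph ω).Reachable c x} ∩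
          openConn c b ∩ {ω | openCluster ω o ∈ 𝒟}) := by
  set μ := prodBernoulli w with hμ
  set X : Set V := {a, o} with hX
  set N : Set (BondConfig V) := {ω | ∀ x ∈ X, ¬ (openGraph ω).Reachable c x} with hN
  set D : Set (BondConfig V) := {ω | openCluster ω o ∈ 𝒟} with hD
  have hoX : o ∈ X := by simp [hX]
  have hcX : c ∉ X := by
    simp only [hX, mem_insert_iff, mem_singleton_iff, not_or]
    exact ⟨fun h => hac h.symm, fun h => hoc h.symm⟩
  -- `Dᶜ` is an increasing event of the open edge cluster of `o`
  have hQ : ∀ ω ω' : BondConfig V, ω ∈ Dᶜ → openEdgeCluster ω o ⊆ openEdgeCluster ω' o → ω' ∈ Dᶜ := by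
    intro ω ω' hω hsub hω'
    apply hω
    refine h𝒟 _ _ (fun y hy => ?_) hω'
    have h1 := (reachable_iff_exists_mem_openEdgeCluster ω o y).1 hy
    exact (reachable_iff_exists_mem_openEdgeCluster ω' o y).2 (h1.imp id fun ⟨e, he, hye⟩ => ⟨e, hsub he, hye⟩)
  have key := rbhk_neg w c o X hoX hcX (openConn c b) Dᶜ (openConn_mono_openEdgeCluster c b) hQ
  change μ.real N * μ.real (N ∩ (openConn c b ∩ Dᶜ)) ≤ μ.real (N ∩ openConn c b) * μ.real (N ∩ Dᶜ) at key
  have hDm : MeasurableSet D := MeasurableSet.of_discrete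
  have s1 : μ.real (N ∩ (openConn c b ∩ Dᶜ)) = μ.real (N ∩ openConn c b) - μ.real (N ∩ openConn c b ∩ D) := by
    have h := measureReal_inter_add_sdiff (μ := μ) (s := N ∩ openConn c b) hDm
    rw [Set.sdiff_eq, inter_assoc N (openConn c b : Set (BondConfig V)) Dᶜ] at h
    linarith
  have s2 : μ.real (N ∩ Dᶜ) = μ.real N - μ.real (N ∩ D) := by
    rw [← measureReal_inter_add_sdiff (s := N) hDm, Set.sdiff_eq]; ring
  rw [s1, s2] at key
  nlinarith [key]

/-! ### The comparison on all of `N`, and the main theorem -/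

/-- **From the event `D` to all of `N`.**  `N = {c↮a} ∩ {c↮o}`, `D = {C_o ∈ 𝒟}` with `𝒟` down-closed: if
`μ(N ∩ D ∩ {c↔b}) ≤ μ(N ∩ D ∩ {a↔b})` and `μ(N ∩ D) > 0` then `μ(N ∩ {c↔b}) ≤ μ(N ∩ {a↔b})` ((1), hypothesis, (2)).
[cite: VandenbergHaggstromKahn2005, Thms. 1.3–1.5 (pp. 6–8)] [cite: KozmaNitzan2024, Lemma 3 (pp. 6–7)] -/
theorem restricted_le_of_le_on_downEvent (w : Sym2 V → unitInterval) (o a b c : V) (hac : a ≠ c) (hoc : o ≠ c)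
    (𝒟 : Set (Set V)) (h𝒟 : ∀ S S' : Set V, S ⊆ S' → S' ∈ 𝒟 → S ∈ 𝒟)
    (hpos : 0 < (prodBernoulli w).real ({ω : BondConfig V | ∀ x ∈ ({a, o} : Set V), ¬ (openGraph ω).Reachable c x} ∩
      {ω | openCluster ω o ∈ 𝒟}))
    (hle : (prodBernoulli w).real ({ω : BondConfig V | ∀ x ∈ ({a, o} : Set V), ¬ (openGraph ω).Reachable c x} ∩
        {ω | openCluster ω o ∈ 𝒟} ∩ openConn c b) ≤
      (prodBernoulli w).real ({ω : BondConfig V | ∀ x ∈ ({a, o} : Set V), ¬ (openGraph ω).Reachable c x} ∩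
        {ω | openCluster ω o ∈ 𝒟} ∩ openConn a b)) :
    (prodBernoulli w).real ({ω : BondConfig V | ∀ x ∈ ({a, o} : Set V), ¬ (openGraph ω).Reachable c x} ∩ openConn c b) ≤
      (prodBernoulli w).real ({ω : BondConfig V | ∀ x ∈ ({a, o} : Set V), ¬ (openGraph ω).Reachable c x} ∩ openConn a b) := by
  set μ := prodBernoulli w with hμ
  set N : Set (BondConfig V) := {ω | ∀ x ∈ ({a, o} : Set V), ¬ (openGraph ω).Reachable c x} with hN
  set D : Set (BondConfig V) := {ω | openCluster ω o ∈ 𝒟} with hD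
  have h1 := posCorr_own_downEvent w o a b c hac hoc 𝒟 h𝒟
  have h2 := negCorr_conn_downEvent w o a b c hac hoc 𝒟 h𝒟
  change μ.real (N ∩ openConn c b) * μ.real (N ∩ D) ≤ μ.real N * μ.real (N ∩ openConn c b ∩ D) at h1
  change μ.real N * μ.real (N ∩ openConn a b ∩ D) ≤ μ.real (N ∩ openConn a b) * μ.real (N ∩ D) at h2
  have e1 : N ∩ openConn c b ∩ D = N ∩ D ∩ openConn c b := inter_right_comm N (openConn c b) D
  have e2 : N ∩ openConn a b ∩ D = N ∩ D ∩ openConn a b := inter_right_comm N (openConn a b) D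
  rw [e1] at h1
  rw [e2] at h2
  have hN0 : 0 ≤ μ.real N := measureReal_nonneg
  have h3 : μ.real N * μ.real (N ∩ D ∩ openConn c b) ≤ μ.real N * μ.real (N ∩ D ∩ openConn a b) :=
    mul_le_mul_of_nonneg_left hle hN0
  exact le_of_mul_le_mul_right (h1.trans (h3.trans h2)) hpos

/-- **MAIN THEOREM — (41) for two relays under every pocket-restricted designation.**  Let `o, b` be vertices,
`a ≠ c` relays with `c ≠ o`, and `𝒟` a down-closed family of vertex sets with `c ∉ S` for every `S ∈ 𝒟`; `D = {C_o ∈ 𝒟}`.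
If `μ({c↔b} ∩ D) ≤ μ({a↔b} ∩ D)` and `μ({c↮a} ∩ {c↮o} ∩ D) > 0`, then
`μ({c↔b} ∩ ({o↔a} ∪ {o↔c})) ≤ μ({o↔b} ∩ ({o↔a} ∪ {o↔c}))` — the pre-FKG inequality (41) at `o` for `c`, `A = {a, c}`.
Theorem 1/Question 7 (`𝒟 = {S | c ∉ S}`), Question 8 (`{S | a, c ∉ S}`), Question 9 (`{S | S ⊆ {o}}`) and the whole family
`{S | S ∩ T = ∅}`, `T ∋ c`, are special cases. [cite: KozmaNitzan2024, Questions 7–9 (§5.5 p. 36), Theorem 1 (pp. 7–8)]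
[cite: VandenbergHaggstromKahn2005, Thms. 1.3–1.5 (pp. 6–8)] -/
theorem block41_pair_of_downEvent (w : Sym2 V → unitInterval) (o b a c : V) (hac : a ≠ c) (hoc : o ≠ c)
    (𝒟 : Set (Set V)) (h𝒟 : ∀ S S' : Set V, S ⊆ S' → S' ∈ 𝒟 → S ∈ 𝒟) (hc𝒟 : ∀ S ∈ 𝒟, c ∉ S)
    (hmin : (prodBernoulli w).real (openConn c b ∩ {ω | openCluster ω o ∈ 𝒟}) ≤
      (prodBernoulli w).real (openConn a b ∩ {ω | openCluster ω o ∈ 𝒟}))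
    (hpos : 0 < (prodBernoulli w).real
      ({ω : BondConfig V | ¬ (openGraph ω).Reachable c a} ∩ {ω | ¬ (openGraph ω).Reachable c o} ∩
        {ω | openCluster ω o ∈ 𝒟})) :
    (prodBernoulli w).real (openConn c b ∩ (openConn o a ∪ openConn o c)) ≤
      (prodBernoulli w).real (openConn o b ∩ (openConn o a ∪ openConn o c)) := by
  set μ := prodBernoulli w with hμ
  set X : Set V := {a, o} with hX
  set N : Set (BondConfig V) := {ω | ∀ x ∈ X, ¬ (openGraph ω).Reachable c x} with hN
  set D : Set (BondConfig V) := {ω | openCluster ω o ∈ 𝒟} with hD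
  have hNiff : ∀ ω : BondConfig V, ω ∈ N ↔ ¬ (openGraph ω).Reachable c a ∧ ¬ (openGraph ω).Reachable c o := by
    intro ω
    simp only [hN, hX, mem_setOf_eq, mem_insert_iff, mem_singleton_iff, forall_eq_or_imp, forall_eq]
  -- on `D`, `o ↮ c`
  have hDoc : ∀ ω : BondConfig V, ω ∈ D → ¬ (openGraph ω).Reachable c o := by
    intro ω hω h
    exact hc𝒟 _ hω (show c ∈ openCluster ω o from h.symm)
  -- (0) restrict the hypothesis to `N`
  have hmC : MeasurableSet (openConn c a : Set (BondConfig V)) := MeasurableSet.of_discrete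
  have hsplit : ∀ E : Set (BondConfig V),
      μ.real (E ∩ D) = μ.real (E ∩ D ∩ openConn c a) + μ.real ((E ∩ D) \ openConn c a) := by
    intro E; rw [measureReal_inter_add_sdiff (s := E ∩ D) hmC]
  have f1 : (openConn c b : Set (BondConfig V)) ∩ D ∩ openConn c a = openConn a b ∩ D ∩ openConn c a := by
    ext ω
    simp only [mem_inter_iff, openConn, mem_setOf_eq]
    constructor
    · rintro ⟨⟨hcb, hd⟩, hca⟩; exact ⟨⟨hca.symm.trans hcb, hd⟩, hca⟩
    · rintro ⟨⟨hab, hd⟩, hca⟩; exact ⟨⟨hca.trans hab, hd⟩, hca⟩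
  have f2 : ∀ y : V, ((openConn y b : Set (BondConfig V)) ∩ D) \ openConn c a = N ∩ D ∩ openConn y b := by
    intro y; ext ω
    simp only [mem_inter_iff, mem_sdiff, hNiff, openConn, mem_setOf_eq]
    constructor
    · rintro ⟨⟨hyb, hd⟩, hnca⟩; exact ⟨⟨⟨hnca, hDoc ω hd⟩, hd⟩, hyb⟩
    · rintro ⟨⟨⟨hnca, -⟩, hd⟩, hyb⟩; exact ⟨⟨hyb, hd⟩, hnca⟩
  have hle : μ.real (N ∩ D ∩ openConn c b) ≤ μ.real (N ∩ D ∩ openConn a b) := by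
    have h := hmin
    rw [hsplit (openConn c b), hsplit (openConn a b), f1, f2 c, f2 a] at h
    linarith
  have hpos' : 0 < μ.real (N ∩ D) := by
    have e : N ∩ D = {ω : BondConfig V | ¬ (openGraph ω).Reachable c a} ∩ {ω | ¬ (openGraph ω).Reachable c o} ∩ D := by
      ext ω; simp only [mem_inter_iff, hNiff, mem_setOf_eq, and_assoc]
    rw [e]; exact hpos
  -- (1)+(2): the comparison on all of `N`
  have hN := restricted_le_of_le_on_downEvent w o a b c hac hoc 𝒟 h𝒟 hpos' hle
  -- (3): transfer onto `N ∩ {a ↔ o}` by the restricted Lemma 3(i)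
  have hcX : c ∉ X := by
    simp only [hX, mem_insert_iff, mem_singleton_iff, not_or]
    exact ⟨fun h => hac h.symm, fun h => hoc h.symm⟩
  have step := knLemma3i_restricted w c a b X hcX (fun h => hac h.symm) (openConn a o) 0
    (openConn_mono_openEdgeCluster a o) le_rfl (by rw [add_zero]; exact hN)
  rw [add_zero] at step
  -- (4): bookkeeping
  refine block41_of_core w o b a c ?_
  have e1 : N ∩ openConn a o ∩ openConn c b = N ∩ openConn c b ∩ openConn a o := inter_right_comm N (openConn a o) _
  have e2 : N ∩ openConn a o ∩ openConn a b = N ∩ openConn a b ∩ openConn a o := inter_right_comm N (openConn a o) _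
  rw [e1, e2]
  exact step

/-! ### Corollaries: the `T`-family and Question 7 restricted -/

/-- **The `T`-family.**  For every vertex set `T` with `c ∈ T`: if `μ({c↔b} ∩ {o↮T}) ≤ μ({a↔b} ∩ {o↮T})` and
`μ({c↮a} ∩ {c↮o} ∩ {o↮T}) > 0` then (41) holds at `o` for `c` with `A = {a, c}` (`𝒟 = {S | S ∩ T = ∅}`).
`T = {a,c}` is Question 8, `T = {c}` the restricted Theorem 1, `T = {o}ᶜ` Question 9's event `{o isolated}`, and `T` a
vertex cut between `o` and the relays the interpolating cases. [cite: KozmaNitzan2024, Questions 7–9 (§5.5 p. 36)] -/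
theorem block41_pair_of_avoid (w : Sym2 V → unitInterval) (o b a c : V) (hac : a ≠ c) (hoc : o ≠ c) (T : Set V)
    (hcT : c ∈ T)
    (hmin : (prodBernoulli w).real (openConn c b ∩ {ω | ∀ t ∈ T, ¬ (openGraph ω).Reachable o t}) ≤
      (prodBernoulli w).real (openConn a b ∩ {ω | ∀ t ∈ T, ¬ (openGraph ω).Reachable o t}))
    (hpos : 0 < (prodBernoulli w).real
      ({ω : BondConfig V | ¬ (openGraph ω).Reachable c a} ∩ {ω | ¬ (openGraph ω).Reachable c o} ∩
        {ω | ∀ t ∈ T, ¬ (openGraph ω).Reachable o t})) :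
    (prodBernoulli w).real (openConn c b ∩ (openConn o a ∪ openConn o c)) ≤
      (prodBernoulli w).real (openConn o b ∩ (openConn o a ∪ openConn o c)) := by
  set 𝒟 : Set (Set V) := {S | ∀ t ∈ T, t ∉ S} with h𝒟def
  have eD : {ω : BondConfig V | openCluster ω o ∈ 𝒟} = {ω | ∀ t ∈ T, ¬ (openGraph ω).Reachable o t} := by
    ext ω; simp only [mem_setOf_eq, h𝒟def, openCluster]
  have h𝒟 : ∀ S S' : Set V, S ⊆ S' → S' ∈ 𝒟 → S ∈ 𝒟 := fun S S' hSS' hS' t ht hts => hS' t ht (hSS' hts)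
  have hc𝒟 : ∀ S ∈ 𝒟, c ∉ S := fun S hS hcS => hS c hcT hcS
  refine block41_pair_of_downEvent w o b a c hac hoc 𝒟 h𝒟 hc𝒟 ?_ ?_
  · rw [eD]; exact hmin
  · rw [eD]; exact hpos

/-- **The `T`-family without weight-`1` pairs** (`w e < 1` for every pair; absent edges are pairs of weight `0`): for
`T ∋ c` with `o ∉ T`, `a ≠ c`, `o ≠ c`, the positive-mass hypothesis is automatic (the empty configuration
lies in `{c↮a} ∩ {c↮o} ∩ {o↮T}`). [cite: KozmaNitzan2024, Questions 7–9 (§5.5 p. 36)] -/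
theorem block41_pair_of_avoid_lt_one (w : Sym2 V → unitInterval) (hw : ∀ e, w e < 1) (o b a c : V) (hac : a ≠ c)
    (hoc : o ≠ c) (T : Set V) (hcT : c ∈ T) (hoT : o ∉ T)
    (hmin : (prodBernoulli w).real (openConn c b ∩ {ω | ∀ t ∈ T, ¬ (openGraph ω).Reachable o t}) ≤
      (prodBernoulli w).real (openConn a b ∩ {ω | ∀ t ∈ T, ¬ (openGraph ω).Reachable o t})) :
    (prodBernoulli w).real (openConn c b ∩ (openConn o a ∪ openConn o c)) ≤
      (prodBernoulli w).real (openConn o b ∩ (openConn o a ∪ openConn o c)) := by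
  refine block41_pair_of_avoid w o b a c hac hoc T hcT hmin (real_pos_of_empty_mem w hw ?_)
  simp only [mem_inter_iff, mem_setOf_eq, reachable_empty_iff]
  exact ⟨⟨fun h => hac h.symm, fun h => hoc h.symm⟩, fun t ht h => hoT (h ▸ ht)⟩

/-- **Theorem 1 / Question 7 for two relays in RESTRICTED form** (`T = {c}`): if `μ({c↔b} ∩ {o↮c}) ≤ μ({a↔b} ∩ {o↮c})`
and `μ({c↮a} ∩ {c↮o}) > 0` then (41) holds at `o` for `c`, `A = {a, c}`.  (The unrestricted hypothesis `μ(c↔b) ≤ μ(a↔b)`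
implies the restricted one by Kozma–Nitzan's Lemma 3(ii), `{c↮o}` being a decreasing event of `C_c`.)
[cite: KozmaNitzan2024, Theorem 1 (pp. 7–8), Lemma 3(ii) (pp. 6–7), Question 7 (p. 36)] -/
theorem block41_pair_of_le_off_c (w : Sym2 V → unitInterval) (o b a c : V) (hac : a ≠ c) (hoc : o ≠ c)
    (hmin : (prodBernoulli w).real (openConn c b ∩ {ω | ¬ (openGraph ω).Reachable o c}) ≤
      (prodBernoulli w).real (openConn a b ∩ {ω | ¬ (openGraph ω).Reachable o c}))
    (hpos : 0 < (prodBernoulli w).real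
      ({ω : BondConfig V | ¬ (openGraph ω).Reachable c a} ∩ {ω | ¬ (openGraph ω).Reachable c o})) :
    (prodBernoulli w).real (openConn c b ∩ (openConn o a ∪ openConn o c)) ≤
      (prodBernoulli w).real (openConn o b ∩ (openConn o a ∪ openConn o c)) := by
  have eT : {ω : BondConfig V | ∀ t ∈ ({c} : Set V), ¬ (openGraph ω).Reachable o t} =
      {ω | ¬ (openGraph ω).Reachable o c} := by
    ext ω; simp only [mem_setOf_eq, mem_singleton_iff, forall_eq]
  refine block41_pair_of_avoid w o b a c hac hoc {c} (mem_singleton c) (by rw [eT]; exact hmin) ?_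
  rw [eT]
  have e : {ω : BondConfig V | ¬ (openGraph ω).Reachable c a} ∩ {ω | ¬ (openGraph ω).Reachable c o} ∩
      {ω | ¬ (openGraph ω).Reachable o c} =
      {ω : BondConfig V | ¬ (openGraph ω).Reachable c a} ∩ {ω | ¬ (openGraph ω).Reachable c o} := by
    ext ω
    simp only [mem_inter_iff, mem_setOf_eq]
    constructor
    · rintro ⟨h, -⟩; exact h
    · rintro ⟨h1, h2⟩; exact ⟨⟨h1, h2⟩, fun h => h2 h.symm⟩
  rw [e]; exact hpos

end KnQ8

end Summit.CriticalPhenomena.PercolationContinuityZ3.Theorems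

end
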